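import Literature.NumberTheory.Automorphic.Liu2021.Def411WeilCarriersIrreducibleOfLemD1
import Literature.NumberTheory.Automorphic.AutomorphicGLnFlathProofs
import Literature.NumberTheory.Automorphic.UnitaryGroupPlaceInclusion
import Mathlib.RingTheory.SimpleModule.Isotypic
import HarnessLib

/-!
# `Coinv(⊗'_v ω_v ∘ Πʳφ, ∏χ_v)` is LOCALLY ISOTYPIC: restricted to the `v`-th factor it is a sum of copies of `Coinv(ω_v ∘ φ_v, χ_v)`

Topic `NumberTheory/GelbartRogawski1991`.  KERNEL ONLY: theorems (no definition, no record, no named fact, no `sorry`).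
Sibling of `FiniteAdelicWeilCentralCoinvariantsIrreducible.lean` (same inputs, «irreducible» replaced by «locally isotypic»):
for a family `𝓢` of LOCAL splittings `s_v : U(J)(F_v) →* S̃p_{ψ_v}(𝕎_v)` ([GelbartRogawski1991, §3.1 Prop. 3.1.1]) the central
`χ`-coinvariants of the place-assembled finite Weil representation `Ω = 𝓢.OmegaPi = ⊗'_v ω_v` ARE `⊗'_v Coinv(ω_v ∘ φ_v, χ_v)`
(✔ `FinLocalSplittings.omegaPi_centralCoinv` ∕ `finiteAdeleRep_centralCoinv`, Flath's easy direction), and a restricted tensor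
product restricted to its `v`-th factor is ISOTYPIC of the local type (✔ `IsRestrictedTensorProductRep.isotypicComponent_eq_top`,
the standard argument behind the uniqueness clause of [Flath1979, Thm. 3]).  This is the LOCAL ISOTYPY that [Liu2021,
Def. 4.11] «`ω(μ, ε, χ) := ⊗'_v ω(μ_v, ε_v, χ_v)`» provides and that the proof of [Liu2021, Thm. 4.18 (2)] («Statement (2)
follows from Lemma D.1», l. 2270) uses to pass from the LOCAL Lemma D.1 (3) to the global non-isomorphy — in the tree: the
hypothesis `hiso` of ✔ `Literature.RepresentationTheory.Liu2021.eq_of_equiv` ∕ `chr_eq_of_equiv` and of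
✔ `Liu2021.hsep_of_lemD1AsPrinted` (`Liu2021/LemD1LocalInjectivity.lean`, the Δ2 bridge's `hsepW` cite leg).

* §1 (generic, `Literature.RepresentationTheory`): `isotypicComponent … = ⊤` (Mathlib `isotypicComponent` of the `k[Γ]`-module
  of a representation) passes along equivariant linear SURJECTIONS (`isotypicComponent_asModule_eq_top_of_surjective`, Mathlib
  `LinearMap.le_comap_isotypicComponent`), does not see the type within its isomorphism class (`…_congr_type`), and — for the
  action on `χ`-coinvariants (`TwistedCoinv.rep`) — does not see the presentation of the acting pair (same relation submodule:
  `TwistedCoinv.isotypicComponent_rep_comp_eq_top_of_ker_eq`) nor a `TwistedCoinv.mapEquiv` (`…_of_mapEquiv`).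
* §2 `finiteAdeleRep_centralCoinv_isotypicComponent_eq_top` — for the tree's place-assembled `finiteAdeleRep K ι r hK = ⊗'_v r_v`
  and a central restricted sub-family `φ_v : H_v →* G_v`: `Coinv(⊗'_v r_v ∘ Πʳφ, ∏χ_v)`, pulled back along ANY restricted family
  `ψ_v : G'_v →* G_v` (✔ `IsRestrictedTensorProductRep.comp`) and restricted to the `v`-th factor `G'_v`, is the sum of its
  `ℂ[G'_v]`-submodules isomorphic to `Coinv(r_v ∘ φ_v, χ_v) ∘ ψ_v`, whenever the latter is irreducible and the unramified vector
  survives off a finite set.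
* §3 (a LINE `W`, `U(J_{VW}) ⊇ U(J_V) ⊗ 1`) `WeilCoinv.isotypicComponent_omega_center_comp_eq_top` — the `U(J_V)(𝔸_f)`-action on
  `Coinv(Ω ∘ (u ↦ u·1_n), χ₁)` (Ω on `U(J_{VW})(𝔸_f)` through `finAdelicEquiv`, the centre `E¹(𝔸_f)` decomposed place by place:
  ✔ `finAdelicEquiv_finAdelicCenter_eq_mapAlong`, ✔ `coe_charOfCenter_eq_finprod`), restricted along any `φloc : G'_v →* U(J_V)(𝔸_f)`
  lying over the coordinate embedding of `ψ_v` (`hsq`), is isotypic of the local type — the local-isotypy twin of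
  ✔ `WeilCoinv.omega_center_isIrreducible_of_local`.

The passage to [Liu2021, Def. 4.11]'s carriers `Def411WeilCarriers.rhoV ∕ rho … ε χ` (reference section, twist, `hfac`) is the
sequel `Liu2021/Def411WeilCarriersLocalIsotypy.lean`.  Nothing of [Liu2021] is asserted; HC_CM is not mentioned by this file.
Cell pub-hodgecm2 (COR-CM), Δ2 BRIDGE cite legs (`hsepW` ∕ `hμsep`); seat prover-pub-hodgecm2-b10-g68-0.

## References
* [Flath1979] D. Flath, *Decomposition of representations into tensor products*, PSPM 33 (1979) part 1, §2 Ex. 2, Thm. 3.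
* [Bump1997] D. Bump, *Automorphic forms and representations* (1997), §3.4 Prop. 3.4.1 (isotypy ∕ uniqueness of local factors).
* [Liu2021] Y. Liu, Camb. J. Math. 9 (2021) = arXiv:2102.11518: Def. 4.11 (l. 2092–2096), Thm. 4.18 (2) with proof (l. 2241,
  2270), App. D §D.1 Step 3 (l. 5221), Lem. D.1 (l. 5227; (3) l. 5233).
* [GelbartRogawski1991] S. Gelbart, J. Rogawski, Invent. Math. 105 (1991), §3.1 Prop. 3.1.1 p. 455 L1–3.
* [Mok2014] C. P. Mok, Mem. AMS 235 (2015), §1 Notation p. 5 (`U(1)` = centre of `U(N)`).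
-/

set_option autoImplicit false

noncomputable section

open scoped MonoidAlgebra RestrictedProduct NumberField
open Filter Set IsDedekindDomain NumberField

/-! ## §1 Generic: `isotypicComponent … = ⊤` along equivariant surjections, isomorphic types, and surjective pull-backs -/

namespace Literature.RepresentationTheory

section Generic

variable {k : Type*} [Field k] {G : Type*} [Group G]
  {W W' V V' : Type*} [AddCommGroup W] [Module k W] [AddCommGroup W'] [Module k W']
  [AddCommGroup V] [Module k V] [AddCommGroup V'] [Module k V']

/-- **Isotypy passes along an equivariant SURJECTION.**  If `f : W → W'` is `k`-linear, onto, and intertwines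
`π` with `π'`, and the `k[G]`-module of `π` is the sum of its submodules isomorphic to `ρ` (`isotypicComponent = ⊤`),
then so is the `k[G]`-module of `π'` (Mathlib `LinearMap.le_comap_isotypicComponent`; the image of a sum of copies of the simple
module `ρ` under an equivariant map is again such a sum — Bump 1997, §3.4, proof of Prop. 3.4.1).
[cite: Bump1997, §3.4 Prop. 3.4.1; FlathCorvallis1979, Theorem 3 (uniqueness clause)] -/
theorem isotypicComponent_asModule_eq_top_of_surjective (π : Representation k G W) (π' : Representation k G W')
    (ρ : Representation k G V) [ρ.IsIrreducible] (f : W →ₗ[k] W') (hf : ∀ (g : G) (w : W), f (π g w) = π' g (f w))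
    (hsurj : Function.Surjective f)
    (h : isotypicComponent k[G] π.asModule ρ.asModule = ⊤) :
    isotypicComponent k[G] π'.asModule ρ.asModule = ⊤ := by
  let T : π.IntertwiningMap π' := f.intertwiningMap_of_isIntertwiningMap π π' hf
  let L : π.asModule →ₗ[k[G]] π'.asModule := Representation.IntertwiningMap.equivLinearMapAsModule _ _ T
  have hL : Function.Surjective L := hsurj
  have hle : (⊤ : Submodule k[G] π.asModule) ≤ (isotypicComponent k[G] π'.asModule ρ.asModule).comap L :=
    h ▸ LinearMap.le_comap_isotypicComponent ρ.asModule L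
  -- `range L = ⊤`
  rw [eq_top_iff]
  intro y _
  obtain ⟨x, rfl⟩ := hL y
  exact hle (Submodule.mem_top : x ∈ (⊤ : Submodule k[G] π.asModule))

/-- **Isotypy does not see the choice of the type within its isomorphism class**: for `ρ ≃ ρ'` (an intertwining
linear equivalence) the `ρ`- and `ρ'`-isotypic components of any `k[G]`-module agree (Mathlib
`LinearEquiv.isotypicComponent_eq`; Bump 1997, §3.4 Prop. 3.4.1: the isotypic type is an isomorphism class).
[cite: Bump1997, §3.4 Prop. 3.4.1] -/
theorem isotypicComponent_asModule_congr_type (π : Representation k G W) (ρ : Representation k G V)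
    (ρ' : Representation k G V') (e : V ≃ₗ[k] V') (he : ∀ (g : G) (v : V), e (ρ g v) = ρ' g (e v)) :
    isotypicComponent k[G] π.asModule ρ.asModule = isotypicComponent k[G] π.asModule ρ'.asModule := by
  let E : ρ.Equiv ρ' := Representation.Equiv.mk e fun g => LinearMap.ext (he g)
  let L : ρ.asModule →ₗ[k[G]] ρ'.asModule :=
    Representation.IntertwiningMap.equivLinearMapAsModule _ _ E.toIntertwiningMap
  have hL : Function.Bijective L := e.bijective
  exact ((LinearEquiv.ofBijective L hL).symm).isotypicComponent_eq.symm

end Generic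

section Coinv

variable {k : Type*} [Field k] {Γ G G' H H' S V : Type*} [Group Γ] [Group G] [Group G'] [Group H] [Group H']
  [AddCommGroup S] [Module k S] [AddCommGroup V] [Module k V]

/-- **Isotypy of the action on `χ`-coinvariants does not see the PRESENTATION of the acting pair** (same relation
submodule, same operators on representatives).  Two commuting pairs `(ρV, ρW)` (groups `G`, `H`) and `(ρV', ρW')` (groups
`G'`, `H'`) on ONE space `S` with `ker ρW χ = ker ρW' χ'`, read on a group `Γ` through `τ : Γ →* G`, `τ' : Γ →* G'` with
`ρV (τ γ) = ρV' (τ' γ)`: if `Coinv ρW χ` restricted along `τ` is `σ`-isotypic, so is `Coinv ρW' χ'` restricted along `τ'`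
(the identity of `S` descends, `Submodule.quotEquivOfEq`) — the situation of [GelbartRogawski1991, §3.1 Remark p. 457]
(two presentations of the Weil coinvariants) read for isotypy instead of irreducibility.
[cite: GelbartRogawski1991, §3.1 Remark p. 457 L4–13; Bump1997, §3.4 Prop. 3.4.1] -/
theorem TwistedCoinv.isotypicComponent_rep_comp_eq_top_of_ker_eq (ρW : Representation k H S) (χ : H →* kˣ)
    (ρW' : Representation k H' S) (χ' : H' →* kˣ) (hker : TwistedCoinv.ker ρW χ = TwistedCoinv.ker ρW' χ')
    (ρV : Representation k G S) (hc : ∀ (g : G) (h : H), Commute (ρV g) (ρW h))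
    (ρV' : Representation k G' S) (hc' : ∀ (g : G') (h : H'), Commute (ρV' g) (ρW' h))
    (τ : Γ →* G) (τ' : Γ →* G') (hττ' : ∀ γ : Γ, ρV (τ γ) = ρV' (τ' γ))
    (σ : Representation k Γ V) [σ.IsIrreducible]
    (h : isotypicComponent k[Γ] (Representation.asModule ((TwistedCoinv.rep χ ρV hc).comp τ)) σ.asModule = ⊤) :
    isotypicComponent k[Γ] (Representation.asModule ((TwistedCoinv.rep χ' ρV' hc').comp τ')) σ.asModule = ⊤ := by
  refine isotypicComponent_asModule_eq_top_of_surjective _ _ σ (Submodule.quotEquivOfEq _ _ hker).toLinearMap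
    (fun γ x => ?_) (Submodule.quotEquivOfEq _ _ hker).surjective h
  obtain ⟨v, rfl⟩ := TwistedCoinv.mk_surjective ρW χ x
  rw [MonoidHom.comp_apply, MonoidHom.comp_apply, TwistedCoinv.rep_mk, hττ', TwistedCoinv.mk_apply,
    TwistedCoinv.mk_apply, LinearEquiv.coe_toLinearMap, Submodule.quotEquivOfEq_mk, Submodule.quotEquivOfEq_mk]
  exact (TwistedCoinv.rep_mk χ' ρV' hc' (τ' γ) v).symm

/-- **Isotypy of the action on `χ`-coinvariants is transported back along `TwistedCoinv.mapEquiv`** (one acting group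
`H`, two spaces `S ≃ S'` with `ρW' h (T v) = e h • T (ρW h v)`, `χ' = e · χ`, and `G`-actions with `ρV' g (T v) = T (ρV g v)`):
if `Coinv ρW' χ'` restricted along `τ : Γ →* G` is `σ`-isotypic, so is `Coinv ρW χ` ([GelbartRogawski1991, §3.1 Remark p. 457]:
coinvariants of two realisations of the Weil representation differing by a relabelling, read for isotypy).
[cite: GelbartRogawski1991, §3.1 Remark p. 457 L4–13; Bump1997, §3.4 Prop. 3.4.1] -/
theorem TwistedCoinv.isotypicComponent_rep_comp_eq_top_of_mapEquiv {S' : Type*} [AddCommGroup S'] [Module k S']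
    (ρW : Representation k H S) (χ : H →* kˣ) (ρW' : Representation k H S') (χ' : H →* kˣ)
    (ρV : Representation k G S) (ρV' : Representation k G S')
    (hc : ∀ (g : G) (h : H), Commute (ρV g) (ρW h)) (hc' : ∀ (g : G) (h : H), Commute (ρV' g) (ρW' h))
    (T : S ≃ₗ[k] S') (e : H → kˣ) (hT : ∀ (h : H) (v : S), ρW' h (T v) = ((e h : kˣ) : k) • T (ρW h v))
    (hχ : ∀ h : H, χ' h = e h * χ h) (hg : ∀ (g : G) (v : S), ρV' g (T v) = T (ρV g v))
    (τ : Γ →* G) (σ : Representation k Γ V) [σ.IsIrreducible]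
    (h : isotypicComponent k[Γ] (Representation.asModule ((TwistedCoinv.rep χ' ρV' hc').comp τ)) σ.asModule = ⊤) :
    isotypicComponent k[Γ] (Representation.asModule ((TwistedCoinv.rep χ ρV hc).comp τ)) σ.asModule = ⊤ := by
  have hg' : ∀ (g : G) (v : S), ρV' g (T v) = (1 : k) • T (ρV g v) := fun g v => by
    rw [one_smul]; exact hg g v
  refine isotypicComponent_asModule_eq_top_of_surjective _ _ σ
    (TwistedCoinv.mapEquiv ρW χ ρW' χ' T e hT hχ).symm.toLinearMap (fun γ y => ?_)
    (TwistedCoinv.mapEquiv ρW χ ρW' χ' T e hT hχ).symm.surjective h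
  rw [LinearEquiv.coe_toLinearMap, LinearEquiv.symm_apply_eq, MonoidHom.comp_apply, MonoidHom.comp_apply,
    ← one_smul k (((TwistedCoinv.mapEquiv ρW χ ρW' χ' T e hT hχ)) _),
    ← TwistedCoinv.mapEquiv_rep ρW χ ρW' χ' ρV ρV' hc hc' T e hT hχ (hg' (τ γ)), LinearEquiv.apply_symm_apply]

end Coinv

end Literature.RepresentationTheory

/-! ## §2 The place-assembled finite-adelic representation: central `χ`-coinvariants of `⊗'_v r_v` are LOCALLY ISOTYPIC -/

namespace Literature.NumberTheory.Automorphic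

open Literature.RepresentationTheory

universe uG uH uG'

section Weil

variable (K : Type) [Field K] [NumberField K] (ι : Type) [Fintype ι] [DecidableEq (HeightOneSpectrum (𝓞 K))]
  {G : HeightOneSpectrum (𝓞 K) → Type uG} [∀ v, Group (G v)] {Kc : ∀ v, Subgroup (G v)}
  (r : ∀ v, Representation ℂ (G v) ↥(SchwartzBruhat (ι → v.adicCompletion K)))
  (hK : ∀ᶠ v in cofinite, unitVec K ι v ∈ (r v).fixedPoints (Kc v))
  {H : HeightOneSpectrum (𝓞 K) → Type uH} [∀ v, Group (H v)] {KH : ∀ v, Subgroup (H v)}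
  (φ : ∀ v, H v →* G v) (hφ : ∀ᶠ v in cofinite, MapsTo (φ v) (KH v) (Kc v))
  {χloc : ∀ v, H v →* ℂˣ}
  {G' : HeightOneSpectrum (𝓞 K) → Type uG'} [∀ v, Group (G' v)] {K' : ∀ v, Subgroup (G' v)}
  (ψ : ∀ v, G' v →* G v) (hψ : ∀ᶠ v in cofinite, MapsTo (ψ v) (K' v) (Kc v))

/-- **`Coinv(⊗'_v r_v ∘ Πʳφ, ∏χ_v)` is LOCALLY ISOTYPIC.**  For the tree's place-assembled `finiteAdeleRep K ι r hK = ⊗'_v r_v`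
on `𝒮((𝔸_{K,f})^ι)`, a central restricted sub-family `φ_v : H_v →* G_v` (`hc`, `hcomm`), local characters `χ_v` with
`χ = ∏_v χ_v` trivial on `KH_v` almost everywhere, and the unramified vector surviving off a finite set: the coinvariants
`Coinv(⊗'_v r_v ∘ Πʳφ, χ)` ARE `⊗'_v Coinv(r_v ∘ φ_v, χ_v)` (✔ `finiteAdeleRep_centralCoinv` with the comparison map of
✔ `exists_centralCoinvMap`); pulled back along any restricted family `ψ_v : G'_v →* G_v` (✔ `IsRestrictedTensorProductRep.comp`)
and restricted to the `v`-th factor, the `ℂ[G'_v]`-module is the sum of its submodules isomorphic to `Coinv(r_v ∘ φ_v, χ_v) ∘ ψ_v`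
whenever the latter is irreducible (✔ `IsRestrictedTensorProductRep.isotypicComponent_eq_top`, Flath).
[cite: Flath1979, §2 Example 2 and Theorem 3 (uniqueness clause); Liu2021, Def. 4.11 (l. 2092–2096)] -/
theorem finiteAdeleRep_centralCoinv_isotypicComponent_eq_top
    (hc : ∀ (v : HeightOneSpectrum (𝓞 K)) (g : G v) (h' : H v),
      Commute (r v g) ((show Representation ℂ (H v) _ from (r v).comp (φ v)) h'))
    (hcomm : ∀ (g : Πʳ v, [G v, Kc v]) (h' : Πʳ v, [H v, KH v]),
      Commute (finiteAdeleRep K ι r hK g)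
        (((finiteAdeleRep K ι r hK).comp (RestrictedProduct.mapAlongMonoidHom H G id Filter.tendsto_id φ hφ)) h'))
    (χ : (Πʳ v, [H v, KH v]) →* ℂˣ)
    (hχ : ∀ g : Πʳ v, [H v, KH v], ((χ g : ℂˣ) : ℂ) = ∏ᶠ v, ((χloc v (g v) : ℂˣ) : ℂ))
    (hχK : ∀ᶠ v in cofinite, ∀ g ∈ KH v, χloc v g = 1)
    {S₁ : Finset (HeightOneSpectrum (𝓞 K))}
    (hx₀N : ∀ v ∉ S₁,
      TwistedCoinv.mk (show Representation ℂ (H v) _ from (r v).comp (φ v)) (χloc v) (unitVec K ι v) ≠ 0)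
    (v : HeightOneSpectrum (𝓞 K))
    [hirr : (show Representation ℂ (G' v) _ from
      (TwistedCoinv.rep (χloc v) (r v) (hc v)).comp (ψ v)).IsIrreducible] :
    isotypicComponent ℂ[G' v]
      (Representation.asModule
        ((show Representation ℂ (Πʳ v, [G' v, K' v]) _ from
          (TwistedCoinv.rep χ (finiteAdeleRep K ι r hK) hcomm).comp
            (RestrictedProduct.mapAlongMonoidHom G' G id Filter.tendsto_id ψ hψ)).comp (mulSingleHom K' v)))
      (Representation.asModule (show Representation ℂ (G' v) _ from
        (TwistedCoinv.rep (χloc v) (r v) (hc v)).comp (ψ v))) = ⊤ := by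
  obtain ⟨J, hJ⟩ := (isRestrictedTensorProductRep_finiteAdeleRep K ι r hK).exists_centralCoinvMap
    (φ := φ) (hφ := hφ) (χloc := χloc) (hq := Filter.Eventually.of_forall fun _ => rfl) χ hχ
  have hRTP := finiteAdeleRep_centralCoinv K ι r hK φ hφ hc hcomm χ hχ hχK hx₀N
    (IsRestrictedTensorProductRep.eventually_mk_mem_fixedPoints hc hK) J hJ
  have hRTP' := hRTP.comp ψ hψ
  exact hRTP'.isotypicComponent_eq_top v

end Weil

end Literature.NumberTheory.Automorphic

/-! ## §3 A LINE `W`: the `U(J_V)(𝔸_f)`-action on `Coinv(Ω ∘ (u ↦ u·1_n), χ₁)` is LOCALLY ISOTYPIC -/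

namespace Literature.NumberTheory.GelbartRogawski1991.UnitaryDualPair.WeilCoinv

open scoped Kronecker Classical
open Literature.NumberTheory.Automorphic Literature.NumberTheory.Automorphic.UnitaryGroup
open Literature.NumberTheory.Weil1964 Literature.RepresentationTheory
open Literature.GroupTheory.RestrictedProductCharacter

universe uG'

variable (F E : Type) [Field F] [NumberField F] [Field E] [NumberField E] [Algebra F E]
variable (c : E ≃ₐ[F] E) (N : ℕ) {n : ℕ} (e : Fin N × Fin 1 ≃ Fin n)
variable (JV : Matrix (Fin N) (Fin N) E) (JW : Matrix (Fin 1) (Fin 1) E)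
variable {TV : Matrix (Fin N) (Fin N) F} {TW : Matrix (Fin 1) (Fin 1) F}
variable [Algebra.IsQuadraticExtension F E] {δ : E} (hcδ : c δ = -δ) (hδ : δ ≠ 0) {d : F}
  (hd : δ * δ = algebraMap F E d)

section OmegaCenter

/-- **Isotypy of the action on `χ`-coinvariants does not see the presentation of the acting pair** — the form of
✔ `TwistedCoinv.isotypicComponent_rep_comp_eq_top_of_ker_eq` whose hypothesis `h` is SHAPED like the conclusion of
✔ `finiteAdeleRep_centralCoinv_isotypicComponent_eq_top` (restriction along `τ₁` then `τ₂`), so that the theorem below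
hands over its `⊗′`-level input by first-order matching and never re-elaborates the restricted-product presentation of
the centre from source. [cite: GelbartRogawski1991, §3.1 Remark p. 457 L4–13; Bump1997, §3.4 Prop. 3.4.1] -/
private theorem isotypicComponent_rep_comp_eq_top_of_shape {k : Type*} [Field k] {Γ G G₂ G' H H' S V : Type*}
    [Group Γ] [Group G] [Group G₂] [Group G'] [Group H] [Group H'] [AddCommGroup S] [Module k S] [AddCommGroup V]
    [Module k V] {ρW : Representation k H S} {χ : H →* kˣ} {ρW' : Representation k H' S} {χ' : H' →* kˣ}
    {ρV : Representation k G S} {hc : ∀ (g : G) (h : H), Commute (ρV g) (ρW h)}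
    {ρV' : Representation k G' S} {hc' : ∀ (g : G') (h : H'), Commute (ρV' g) (ρW' h)}
    {τ₁ : G₂ →* G} {τ₂ : Γ →* G₂} {τ' : Γ →* G'} {σ : Representation k Γ V} [σ.IsIrreducible]
    (h : isotypicComponent k[Γ] (Representation.asModule
      ((show Representation k G₂ _ from (TwistedCoinv.rep χ ρV hc).comp τ₁).comp τ₂)) σ.asModule = ⊤)
    (hker : TwistedCoinv.ker ρW χ = TwistedCoinv.ker ρW' χ')
    (hττ' : ∀ γ : Γ, ρV (τ₁ (τ₂ γ)) = ρV' (τ' γ)) :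
    isotypicComponent k[Γ] (Representation.asModule ((TwistedCoinv.rep χ' ρV' hc').comp τ')) σ.asModule = ⊤ :=
  TwistedCoinv.isotypicComponent_rep_comp_eq_top_of_ker_eq ρW χ ρW' χ' hker ρV hc ρV' hc' (τ₁.comp τ₂) τ' hττ' σ h

/-- **The relation submodule of the `χ`-coinvariants does not see the presentation of the acting pair**: for a
surjection `ζ : H' ↠ H` with `ρW' h' = ρW (ζ h')` and `χ' h' = χ (ζ h')` pointwise, `ker ρW χ = ker ρW' χ'`
(✔ `TwistedCoinv.ker_comp_of_surjective` + ✔ `TwistedCoinv.ker_eq_of_forall_smul` at `e = 1`; stated generically so that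
the theorem below discharges it by pointwise identities, without rewriting inside the place-assembled terms).
[cite: Liu2021, App. D §D.1 Step 3 (l. 5219); Bump1997, §4.2 (twisting a representation by a character)] -/
private theorem ker_eq_ker_of_comp_surjective {k : Type*} [Field k] {H H' S : Type*} [Group H] [Group H']
    [AddCommGroup S] [Module k S] (ρW : Representation k H S) (χ : H →* kˣ) (ρW' : Representation k H' S)
    (χ' : H' →* kˣ) (ζ : H' →* H) (hζ : Function.Surjective ζ) (hρ : ∀ (h' : H') (v : S), ρW' h' v = ρW (ζ h') v)
    (hχ : ∀ h' : H', χ' h' = χ (ζ h')) : TwistedCoinv.ker ρW χ = TwistedCoinv.ker ρW' χ' := by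
  rw [← TwistedCoinv.ker_comp_of_surjective ρW χ ζ hζ]
  exact (TwistedCoinv.ker_eq_of_forall_smul (fun _ => 1) (fun h' v => by rw [Units.val_one, one_smul]; exact hρ h' v)
    (fun h' => by rw [one_mul]; exact hχ h')).symm

/-- **The `U(J_V)(𝔸_f)`-action on `Coinv(Ω ∘ (u ↦ u·1_n), χ₁)` is LOCALLY ISOTYPIC** (line `W`, `χ₁` continuous) — the
local-isotypy twin of ✔ `omega_center_isIrreducible_of_local`.  DATA: the local splittings `𝓢` of `U(J_{VW})(F_v)`; a
restricted family of homomorphisms `ψ_v : G'_v →* U(J_{VW})(F_v)` (the consumer's local groups, e.g. `U(J_V)(F_v)` through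
`k ↦ k ⊗ 1`); at the place `v` a homomorphism `φloc : G'_v →* U(J_V)(𝔸_f)` whose composite with `k ↦ reindex (k ⊗ 1)` and
`finAdelicEquiv` is the coordinate embedding of `ψ_v` (`hsq` — for `U(J_V)(F_v)`: `inclPlace v`).  HYPOTHESES: the local
central quotient `Coinv(ω_v ∘ (local centre), χ_{1,v})` pulled back along `ψ_v` is irreducible (`hirr`; [Liu2021, App. D
Lem. D.1, first sentence]) and the class of `1_{𝒪_vⁿ}` is non-zero off a finite `S₁` (Def. 4.11 «unramified for all but
finitely many `v`»).  CONCLUSION: restricted along `φloc`, the `U(J_V)(𝔸_f)`-representation `TwistedCoinv.rep χ₁ (Ω ∘ (k ↦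
reindex (k ⊗ 1)))` on `Coinv(Ω ∘ (u ↦ u·1_n), χ₁)` is the sum of its `ℂ[G'_v]`-submodules isomorphic to that local quotient.
PROOF: §2 on the place-assembled carrier (the centre is `Πʳ(localCenter)` place by place, `χ₁ = ∏ χ_{1,v}` —
✔ `finAdelicEquiv_finAdelicCenter_eq_mapAlong`, ✔ `coe_charOfCenter_eq_finprod`), then the identity of `𝒮((𝔸_F^∞)ⁿ)` descends to
an equivariant identification of the two coinvariant spaces (same relation submodule, ✔ `TwistedCoinv.ker_eq_of_forall_smul` ∕
`ker_comp_of_surjective`) — §1.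
[cite: Liu2021, Def. 4.11 (l. 2092–2096), App. D §D.1 Step 3 (l. 5221), Lem. D.1 (l. 5227); Flath1979, §2 Example 2 and Theorem 3 (uniqueness clause)] -/
theorem isotypicComponent_omega_center_comp_eq_top (hV : TV.IsSymm) (hW : TW.IsSymm)
    (hJV : JV = TV.map (algebraMap F E)) (hJW : JW = TW.map (algebraMap F E)) (hJW0 : JW 0 0 ≠ 0)
    (𝓢 : LocalSplitting.FinLocalSplittings F E c n hcδ hδ hd (gram F e TV TW) (isSymm_gram F e hV hW)
      (reindex_kronecker_eq_gram_map F E e hJV hJW))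
    {G' : HeightOneSpectrum (𝓞 F) → Type uG'} [∀ v, Group (G' v)] {K' : ∀ v, Subgroup (G' v)}
    (ψ : ∀ v, G' v →* localPi E c n (Matrix.reindex e e (JV ⊗ₖ JW)) v)
    (hψ : ∀ᶠ v in cofinite, MapsTo (ψ v) (K' v) (localInt E c n (Matrix.reindex e e (JV ⊗ₖ JW)) v))
    {χ₁ : finAdelicOne F E c →* ℂˣ} (hχ₁ : Continuous χ₁)
    {S₁ : Finset (HeightOneSpectrum (𝓞 F))}
    (hx₀N : ∀ v ∉ S₁,
      TwistedCoinv.mk (show Representation ℂ (localPi E c 1 JW v) _ from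
          (𝓢.omegaLoc v).comp (localCenter E c n (Matrix.reindex e e (JV ⊗ₖ JW)) JW hJW0 v))
        (localCharOfCenter F E c JW hJW0 χ₁ v) (unitVec F (Fin n) v) ≠ 0)
    (v : HeightOneSpectrum (𝓞 F))
    [hirr : (show Representation ℂ (G' v) _ from
      (TwistedCoinv.rep (localCharOfCenter F E c JW hJW0 χ₁ v) (𝓢.omegaLoc v)
        (commute_omegaLoc_localCenter F E c N e JV JW hcδ hδ hd hV hW hJV hJW hJW0 𝓢 v)).comp (ψ v)).IsIrreducible]
    (φloc : G' v →* finAdelic F E c N JV)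
    (hsq : ∀ g : G' v,
      finAdelicEquiv F E c n (Matrix.reindex e e (JV ⊗ₖ JW)) (finPairEmb F E c N 1 e JV JW (φloc g, 1)) =
        RestrictedProduct.mapAlongMonoidHom G' (fun v => localPi E c n (Matrix.reindex e e (JV ⊗ₖ JW)) v) id
          Filter.tendsto_id ψ hψ (mulSingleHom K' v g)) :
    isotypicComponent ℂ[G' v]
      (Representation.asModule ((TwistedCoinv.rep χ₁
        (show Representation ℂ (finAdelic F E c N JV) _ from
          𝓢.Omega.comp ((finPairEmb F E c N 1 e JV JW).comp (MonoidHom.inl _ _)))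
        (commute_omega_finPairEmb_finAdelicCenter F E c N e JV JW hcδ hδ hd hV hW hJV hJW 𝓢)).comp φloc))
      (Representation.asModule (show Representation ℂ (G' v) _ from
        (TwistedCoinv.rep (localCharOfCenter F E c JW hJW0 χ₁ v) (𝓢.omegaLoc v)
          (commute_omegaLoc_localCenter F E c N e JV JW hcδ hδ hd hV hW hJV hJW hJW0 𝓢 v)).comp (ψ v))) = ⊤ := by
  -- the place-by-place centre `φ`, its integrality, the presentation `ζ : E¹(𝔸_f) ↠ Πʳ_v U(J_W)(F_v)` and `χ₁` on `Πʳ`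
  have hφ : ∀ᶠ v in cofinite, MapsTo (localCenter E c n (Matrix.reindex e e (JV ⊗ₖ JW)) JW hJW0 v)
      ((localInt E c 1 JW v : Subgroup (localPi E c 1 JW v)) : Set (localPi E c 1 JW v))
      ((localInt E c n (Matrix.reindex e e (JV ⊗ₖ JW)) v : Subgroup (localPi E c n (Matrix.reindex e e (JV ⊗ₖ JW)) v)) :
        Set (localPi E c n (Matrix.reindex e e (JV ⊗ₖ JW)) v)) :=
    Eventually.of_forall fun v => localCenter_mapsTo_localInt E c n (Matrix.reindex e e (JV ⊗ₖ JW)) JW hJW0 v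
  have hζ := finAdelicEquiv_comp_finAdelicCenter_surjective F E c JW hJW0
  -- §A: ⊗′ + Flath's isotypy of the local factor under the big group, pulled back along `ψ` (`hcomm` — `Ω_Π` commutes
  -- with `Ω_Π ∘ Πʳ(localCenter)` — supplied inline, its statement instantiated by the lemma)
  have hA := finiteAdeleRep_centralCoinv_isotypicComponent_eq_top F (Fin n) 𝓢.omegaLoc 𝓢.unitVec_mem_fixedPoints
    (fun v => localCenter E c n (Matrix.reindex e e (JV ⊗ₖ JW)) JW hJW0 v) hφ
    (χloc := fun v => localCharOfCenter F E c JW hJW0 χ₁ v) ψ hψ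
    (commute_omegaLoc_localCenter F E c N e JV JW hcδ hδ hd hV hW hJV hJW hJW0 𝓢)
    (fun g h' => by
      obtain ⟨u, rfl⟩ := hζ h'
      exact (commute_mapAlong_localCenter F E c N e JV JW hJW0 g u).map 𝓢.OmegaPi)
    (charOfCenter F E c JW hJW0 χ₁) (coe_charOfCenter_eq_finprod F E c JW hJW0 hχ₁)
    (eventually_localCharOfCenter_eq_one F E c JW hJW0 hχ₁) hx₀N v
  -- §B: the identity of `𝒮((𝔸_F^∞)ⁿ)` descends to an equivariant identification of the two coinvariant spaces — the
  -- relation submodules agree (first goal): `charOfCenter χ₁ ∘ ζ = χ₁` (✔ `charOfCenter_comp`) and the `W`-action through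
  -- `ζ` IS `Ω ∘ (u ↦ u·1_n)` (✔ `finAdelicEquiv_finAdelicCenter_eq_mapAlong`, read through `Ω = Ω_Π ∘ finAdelicEquiv`)
  refine isotypicComponent_rep_comp_eq_top_of_shape hA ?_ fun g => ?_
  · exact ker_eq_ker_of_comp_surjective _ _ _ _ _ hζ
      (fun u f => (𝓢.Omega_apply _ f).trans (congrArg (fun g => 𝓢.OmegaPi g f)
        (finAdelicEquiv_finAdelicCenter_eq_mapAlong F E c n (Matrix.reindex e e (JV ⊗ₖ JW)) JW hJW0 u)))
      fun u => (DFunLike.congr_fun (charOfCenter_comp F E c JW hJW0 χ₁) u).symm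
  -- the operators agree: `Ω_Π (mulSingle v (ψ_v g)) = Ω (reindex (φloc g ⊗ 1))` (`hsq`)
  · rw [← hsq g]
    rfl

end OmegaCenter

end Literature.NumberTheory.GelbartRogawski1991.UnitaryDualPair.WeilCoinv

end
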